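import Summits.ResolutionOfSingularities.ResolutionOfSingularities.Theorems.EquisingularLiftEquisingularLiftNatDeltaCriterionGeneric
import Literature.AlgebraicGeometry.Resolution.Dehomogenization
import Mathlib
import HarnessLib

/-!
# [OURS · L1 W4.5(b)] T-ΔLIFT — EXISTENCE OF A Δ-REGULAR CONE LIFT: for a form `g ∈ k[T]_d` whose trace has finitely
# many singular points on each chart there is a homogeneous lift `Φ = G + c·ϖ·M ∈ O[T]_d` whose every dehomogenised
# Δ-curve `O[T_j : j ≠ i]/(Φ(Tᵢ := 1))` is regular along `ϖ`
# (crux `EquisingularLiftNat` = stmt-ResolutionOfSingularities-20038, line `sections`, stub `stub_elnat_tcDeltaPointResolution`)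

NOT a statement of any manuscript. Helper file of the chain res-L1-w45b (cell `res-hironaka`, rung L, slot
W4.5(b)); AI-written, weaker than expert review; filed `--supports stmt-ResolutionOfSingularities-20038 --as helper`.

WHERE IT SITS (res-L1-w45b-lead-2 ACK/NAMING 2026-08-27T08:06:58Z, RE-CUT 08:19:04Z): the lift hypothesis `HΔ(AdmTC)`
of res-D-pv-029's K4 `target_elnat_of_deltaPointResolution` (p512946) asks, for the reduced trace `Z = V(g) ⊂ e ≅ ℙ^{r-1}_k`
of a tangent cone (res-type-097's T-TCONE), for an UPSTAIRS centre `C` that is regular, `O`-flat, inside the carrier and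
with `C|_{special fibre} = Z`. res-type-100's T-CARRIER-Δ takes `C := St_τ(V(Φ(c))) ⊔ E` for a CONE `Φ` and proves
regularity (F3b `isRegular_carrierDelta_subscheme`, p513634) under the chart-wise HYPOTHESIS «every localisation of
`Λ[T_j : j ≠ i] ⧸ (Φ(Tᵢ := 1))` at a prime containing the uniformizer is regular». This file PRODUCES such a `Φ`:
* `exists_isHomogeneous_map_eq_of_surjective` — homogeneous forms lift along a surjective ring map (coefficientwise);
* `exists_isHomogeneous_forall_dehomogenize_notMem` — over an INFINITE field, a form of degree `d` whose
  dehomogenisations avoid finitely many proper ideals (Mathlib `Submodule.exists_forall_notMem_of_forall_ne_top` on the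
  degree-`d` forms: each condition is a proper subspace because `Tᵢ^d ↦ 1`);
* `subsingleton_badResidue_model`, `isRegularLocalRing_localization_deltaCurve_of_notMem_sq_model_pt`,
  `deltaRegularGeneric_mul_model` — the generic-lift theorem (Δ4, p513713) with the residues read through ANY model
  `π : O ↠ k`, `ker π = (ϖ)`, of the residue field;
* **`exists_isHomogeneous_lift_deltaRegular`** (T-ΔLIFT): `O` a DVR, `ϖ` irreducible, `π : O ↠ k` onto an infinite field
  with `ker π = (ϖ)`, `g ∈ k[T_0, …, T_{r-1}]` homogeneous of degree `d`; if on every chart `i` the primes `𝔮 ∋ g(Tᵢ := 1)`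
  of `k[T_j : j ≠ i]` with `g(Tᵢ := 1) ∈ 𝔪_𝔮²` are finitely many (finitely many non-regular points of the trace), then
  THERE IS a form `Φ ∈ O[T]_d` with `π Φ = g` such that for every chart `i` and every prime `Q ∋ ϖ` of
  `O[T_j : j ≠ i] ⧸ (Φ(Tᵢ := 1))` the localisation is a regular local ring. (`π Φ = g` keeps the «same initial form» of
  T-TCONE, so the special fibre of the Δ-centre is still `Z`.)

References: H. Matsumura, *Commutative Ring Theory* (1986), Thm. 14.2. res-L1-w45b-lead-2 NAMING 08:06:58Z; res-type-100
F3b; res-D-pv-029 K4 (OURS planning texts / tree files, index only).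
-/

set_option linter.dupNamespace false -- mandated namespace `Summit.<Summit>.<Problem>` of this single-conjunct summit
set_option linter.overlappingInstances false -- signatures carry both [IsDomain O] and [IsDiscreteValuationRing O] (Mathlib's class takes the former as a parameter)

noncomputable section

namespace Summit.ResolutionOfSingularities.ResolutionOfSingularities.Cruxes.EquisingularLiftNat.Sections

open MvPolynomial IsLocalRing Literature.AlgebraicGeometry.Resolution
open Summit.ResolutionOfSingularities.ResolutionOfSingularities.Theorems

universe u

/-! ## Homogeneous lifts along a surjective ring map -/

section Lift

/-- **Forms lift to forms.** For a surjective ring map `f : R → S` and a form `g ∈ S[x_σ]` of degree `d` there is a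
form `G ∈ R[x_σ]` of degree `d` with `f G = g` (lift the coefficients on the support). [folklore] [OURS · L1 W4.5b] -/
theorem exists_isHomogeneous_map_eq_of_surjective {R S : Type*} [CommRing R] [CommRing S] (f : R →+* S)
    (hf : Function.Surjective f) {σ : Type*} {d : ℕ} (g : MvPolynomial σ S) (hg : g.IsHomogeneous d) :
    ∃ G : MvPolynomial σ R, G.IsHomogeneous d ∧ MvPolynomial.map f G = g := by
  classical
  choose s hs using hf
  refine ⟨∑ m ∈ g.support, monomial m (s (g.coeff m)), ?_, ?_⟩
  · refine IsHomogeneous.sum _ _ _ fun m hm => isHomogeneous_monomial _ ?_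
    rw [Finsupp.degree_eq_weight_one]
    exact hg (mem_support_iff.mp hm)
  · rw [map_sum]
    simp_rw [map_monomial, hs]
    exact support_sum_monomial_coeff g

end Lift

/-! ## A form whose dehomogenisations avoid finitely many proper ideals -/

section Avoid

variable {k : Type u} [Field k] [Infinite k]

/-- **Avoidance.** Over an infinite field `k`: given finitely many pairs `(i_t, 𝔮_t)` of a chart index `i_t` and a
PROPER ideal `𝔮_t ⊂ k[T_j : j ≠ i_t]`, there is a form `M ∈ k[T_0, …, T_{r-1}]` of any prescribed degree `d` with
`M(T_{i_t} := 1) ∉ 𝔮_t` for all `t`: the forms of degree `d` failing condition `t` form a PROPER subspace (it misses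
`T_{i_t}^d ↦ 1`), and a vector space over an infinite field is not a finite union of proper subspaces (Mathlib
`Submodule.exists_forall_notMem_of_forall_ne_top`). [folklore] [OURS · L1 W4.5b] -/
theorem exists_isHomogeneous_forall_dehomogenize_notMem {r : ℕ} (d : ℕ) {ι : Type*} [Finite ι] (i : ι → Fin r)
    (𝔮 : ∀ t : ι, Ideal (MvPolynomial {j : Fin r // j ≠ i t} k)) (h𝔮 : ∀ t, 𝔮 t ≠ ⊤) :
    ∃ M : MvPolynomial (Fin r) k, M.IsHomogeneous d ∧ ∀ t, dehomogenize (i t) M ∉ 𝔮 t := by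
  let V : Submodule k (MvPolynomial (Fin r) k) := homogeneousSubmodule (Fin r) k d
  let p : ι → Submodule k V := fun t =>
    ((𝔮 t).restrictScalars k).comap ((dehomogenize (i t)).toLinearMap ∘ₗ V.subtype)
  have hp : ∀ t, p t ≠ ⊤ := by
    intro t ht
    have hmem : (⟨X (i t) ^ d, isHomogeneous_X_pow _ _⟩ : V) ∈ p t := by rw [ht]; exact Submodule.mem_top
    have h1 : dehomogenize (i t) (X (i t) ^ d : MvPolynomial (Fin r) k) ∈ 𝔮 t := hmem
    rw [map_pow, MvPolynomial.aeval_X, killVar_self, one_pow] at h1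
    exact h𝔮 t ((Ideal.eq_top_iff_one _).mpr h1)
  obtain ⟨x, hx⟩ := Submodule.exists_forall_notMem_of_forall_ne_top p hp
  exact ⟨x.1, x.2, fun t ht => hx t ht⟩

end Avoid

/-! ## The generic-lift theorem with the residues read through a model `π : O ↠ k` of the residue field -/

section GenericModel

variable {O : Type u} [CommRing O] [IsDomain O] [IsDiscreteValuationRing O] {ϖ : O}
variable {σ : Type u} [Finite σ]
variable {k : Type u} [Field k]

omit [IsDomain O] [IsDiscreteValuationRing O] [Finite σ] in
/-- `ker (π_*) = (ϖ)` on polynomial rings when `ker π = (ϖ)`. [folklore] -/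
theorem ker_map_eq_span_C_of_ker_eq (π : O →+* k) (hker : RingHom.ker π = Ideal.span {ϖ}) :
    RingHom.ker (MvPolynomial.map (σ := σ) π) = Ideal.span {(C ϖ : MvPolynomial σ O)} := by
  rw [MvPolynomial.ker_map, hker, Ideal.map_span, Set.image_singleton]

omit [IsDomain O] [IsDiscreteValuationRing O] [Finite σ] in
/-- `π_* (g + c·ϖ·h) = π_* g` when `π ϖ = 0`. [folklore] -/
theorem map_add_C_mul_mul_of_map_eq_zero (π : O →+* k) (hπϖ : π ϖ = 0) (c : O) (g h : MvPolynomial σ O) :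
    MvPolynomial.map π (g + C (c * ϖ) * h) = MvPolynomial.map π g := by
  rw [map_add, map_mul, map_C, map_mul π, hπϖ, mul_zero, C_0, zero_mul, add_zero]

/-- **(Δ2, pointwise, model form).** If `π F ∉ 𝔪_𝔮²` at the point `𝔮` of `k[x_σ]` below the prime `Q` of `O[x_σ]/(F)`
(`(π_*)⁻¹ 𝔮 = Q ∩ O[x_σ]`), then `(O[x_σ]/(F))_Q` is a regular local ring. [cite: Matsumura1987, Thm. 14.2]
[OURS · L1 W4.5b] -/
theorem isRegularLocalRing_localization_deltaCurve_of_notMem_sq_model_pt (π : O →+* k) {F : MvPolynomial σ O}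
    (Q : Ideal (MvPolynomial σ O ⧸ Ideal.span {F})) [Q.IsPrime]
    (𝔮 : PrimeSpectrum (MvPolynomial σ k))
    (h𝔮 : 𝔮.asIdeal.comap (MvPolynomial.map π) = Q.comap (Ideal.Quotient.mk (Ideal.span {F})))
    (h1 : algebraMap (MvPolynomial σ k) (Localization.AtPrime 𝔮.asIdeal) (MvPolynomial.map π F) ∉
      maximalIdeal (Localization.AtPrime 𝔮.asIdeal) ^ 2) :
    IsRegularLocalRing (Localization.AtPrime Q) := by
  haveI : IsRegularLocalRing (Localization.AtPrime (Q.comap (Ideal.Quotient.mk (Ideal.span {F})))) :=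
    IsRegularRing.isRegularLocalRing_localization _
  exact isRegularLocalRing_localization_quotient_of_notMem_sq Q
    (notMem_sq_of_map_notMem_sq (MvPolynomial.map (σ := σ) π) 𝔮.asIdeal
      (Q.comap (Ideal.Quotient.mk (Ideal.span {F}))) h𝔮.symm h1)

/-- **(Δ3, model form) At most one bad residue class,** read through `π : O → k` with `ker π = (ϖ)`: for `g h ∈ O[x_σ]`
and a prime `P ∋ ϖ` of `O[x_σ]` with `h ∉ P`, the values `π c` of the `c ∈ O` with `g + c·ϖ·h ∈ 𝔪_P²` form a
subsingleton. [folklore] [OURS · L1 W4.5b] -/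
theorem subsingleton_badResidue_model (hϖ : Irreducible ϖ) (π : O →+* k) (hker : RingHom.ker π = Ideal.span {ϖ})
    (g h : MvPolynomial σ O) (P : Ideal (MvPolynomial σ O)) [P.IsPrime] (hP : (C ϖ : MvPolynomial σ O) ∈ P)
    (hh : h ∉ P) :
    {r : k | ∃ c : O, π c = r ∧
      algebraMap (MvPolynomial σ O) (Localization.AtPrime P) (g + C (c * ϖ) * h) ∈
        maximalIdeal (Localization.AtPrime P) ^ 2}.Subsingleton := by
  rintro r₁ ⟨c₁, rfl, h₁⟩ r₂ ⟨c₂, rfl, h₂⟩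
  have h := subsingleton_badResidue hϖ g h P hP hh ⟨c₁, rfl, h₁⟩ ⟨c₂, rfl, h₂⟩
  rw [Ideal.Quotient.eq, ← hker, RingHom.mem_ker, map_sub, sub_eq_zero] at h
  exact h

/-- **(Δ4, model form) Generic regularity of the lifts `g + c·ϖ·h` along the special fibre,** with the trace read over
ANY model `π : O ↠ k` (`ker π = (ϖ)`) of the residue field: if the primes `𝔮 ∋ π g` of `k[x_σ]` with `π g ∈ 𝔪_𝔮²`
are finitely many and `π h` lies in none of them, there is a finite set `S ⊂ k` such that for every `c ∈ O` with
`π c ∉ S` the Δ-curve `O[x_σ]/(g + c·ϖ·h)` is a regular local ring at every prime containing `ϖ`. (Proof as for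
`deltaRegularGeneric_mul`, p513713, with `π` in place of the residue map.) [cite: Matsumura1987, Thm. 14.2]
[OURS · L1 W4.5b] -/
theorem deltaRegularGeneric_mul_model (hϖ : Irreducible ϖ) (π : O →+* k) (hπ : Function.Surjective π)
    (hker : RingHom.ker π = Ideal.span {ϖ}) (g h : MvPolynomial σ O)
    (hfin : {𝔮 : PrimeSpectrum (MvPolynomial σ k) | MvPolynomial.map π g ∈ 𝔮.asIdeal ∧
      algebraMap (MvPolynomial σ k) (Localization.AtPrime 𝔮.asIdeal) (MvPolynomial.map π g) ∈
        maximalIdeal (Localization.AtPrime 𝔮.asIdeal) ^ 2}.Finite)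
    (havoid : ∀ 𝔮 : PrimeSpectrum (MvPolynomial σ k), MvPolynomial.map π g ∈ 𝔮.asIdeal →
      algebraMap (MvPolynomial σ k) (Localization.AtPrime 𝔮.asIdeal) (MvPolynomial.map π g) ∈
        maximalIdeal (Localization.AtPrime 𝔮.asIdeal) ^ 2 →
      MvPolynomial.map π h ∉ 𝔮.asIdeal) :
    ∃ S : Finset k, ∀ c : O, π c ∉ S →
      letI A := MvPolynomial σ O
      letI I : Ideal A := Ideal.span {g + C (c * ϖ) * h}
      ∀ (Q : Ideal (A ⧸ I)) [Q.IsPrime], Ideal.Quotient.mk I (C ϖ : A) ∈ Q →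
        IsRegularLocalRing (Localization.AtPrime Q) := by
  classical
  have hkerC : RingHom.ker (MvPolynomial.map (σ := σ) π) = Ideal.span {(C ϖ : MvPolynomial σ O)} :=
    ker_map_eq_span_C_of_ker_eq π hker
  have hsurj : Function.Surjective (MvPolynomial.map (σ := σ) π) := MvPolynomial.map_surjective _ hπ
  have hπϖ : π ϖ = 0 := by
    rw [← RingHom.mem_ker, hker]
    exact Ideal.mem_span_singleton_self ϖ
  have hredϖ : MvPolynomial.map (σ := σ) π (C ϖ) = 0 := by rw [map_C, hπϖ, C_0]
  -- the excluded residues: the bad residues of the finitely many bad primes avoided by `π h`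
  have hEsub : ∀ 𝔮 : PrimeSpectrum (MvPolynomial σ k), MvPolynomial.map π h ∉ 𝔮.asIdeal →
      {r : k | ∃ c : O, π c = r ∧
        algebraMap (MvPolynomial σ O) (Localization.AtPrime (𝔮.asIdeal.comap (MvPolynomial.map (σ := σ) π)))
          (g + C (c * ϖ) * h) ∈ maximalIdeal _ ^ 2}.Subsingleton := by
    intro 𝔮 hh𝔮
    have hPϖ : (C ϖ : MvPolynomial σ O) ∈ 𝔮.asIdeal.comap (MvPolynomial.map (σ := σ) π) := by
      rw [Ideal.mem_comap, hredϖ]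
      exact Ideal.zero_mem _
    have hhP : h ∉ 𝔮.asIdeal.comap (MvPolynomial.map (σ := σ) π) := by rwa [Ideal.mem_comap]
    exact subsingleton_badResidue_model hϖ π hker g h _ hPϖ hhP
  have hSfin := hfin.biUnion fun 𝔮 h𝔮 => (hEsub 𝔮 (havoid 𝔮 h𝔮.1 h𝔮.2)).finite
  refine ⟨hSfin.toFinset, fun c hc => ?_⟩
  intro Q _ hQϖ
  -- the prime `P = Q ∩ A ⊇ (g + cϖh, ϖ)` of `A` and its image `𝔮 ∋ π g` in `k[x_σ]`
  have hGP : g + C (c * ϖ) * h ∈ Q.comap (Ideal.Quotient.mk (Ideal.span {g + C (c * ϖ) * h})) := by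
    rw [Ideal.mem_comap, Ideal.Quotient.eq_zero_iff_mem.mpr (Ideal.mem_span_singleton_self _)]
    exact Q.zero_mem
  have hϖP : (C ϖ : MvPolynomial σ O) ∈ Q.comap (Ideal.Quotient.mk (Ideal.span {g + C (c * ϖ) * h})) := by
    rw [Ideal.mem_comap]; exact hQϖ
  have hgP : g ∈ Q.comap (Ideal.Quotient.mk (Ideal.span {g + C (c * ϖ) * h})) := by
    have h' := sub_mem hGP (Ideal.mul_mem_right h _ (Ideal.mul_mem_left _ (C c) hϖP))
    have e : g + C (c * ϖ) * h - C c * C ϖ * h = g := by rw [C_mul]; ring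
    rwa [e] at h'
  have hkerP : RingHom.ker (MvPolynomial.map (σ := σ) π) ≤
      Q.comap (Ideal.Quotient.mk (Ideal.span {g + C (c * ϖ) * h})) := by
    rw [hkerC, Ideal.span_singleton_le_iff_mem]; exact hϖP
  haveI h𝔮prime : ((Q.comap (Ideal.Quotient.mk (Ideal.span {g + C (c * ϖ) * h}))).map
      (MvPolynomial.map (σ := σ) π)).IsPrime :=
    Ideal.map_isPrime_of_surjective hsurj hkerP
  let 𝔮 : PrimeSpectrum (MvPolynomial σ k) :=
    ⟨(Q.comap (Ideal.Quotient.mk (Ideal.span {g + C (c * ϖ) * h}))).map (MvPolynomial.map π), h𝔮prime⟩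
  have hcomapq : 𝔮.asIdeal.comap (MvPolynomial.map (σ := σ) π) =
      Q.comap (Ideal.Quotient.mk (Ideal.span {g + C (c * ϖ) * h})) := by
    change ((Q.comap (Ideal.Quotient.mk (Ideal.span {g + C (c * ϖ) * h}))).map _).comap _ = _
    rw [Ideal.comap_map_of_surjective _ hsurj, ← RingHom.ker_eq_comap_bot, sup_eq_left.mpr hkerP]
  have hgq : MvPolynomial.map π g ∈ 𝔮.asIdeal := Ideal.mem_map_of_mem _ hgP
  by_cases hcase : algebraMap (MvPolynomial σ k) (Localization.AtPrime 𝔮.asIdeal) (MvPolynomial.map π g) ∈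
      maximalIdeal (Localization.AtPrime 𝔮.asIdeal) ^ 2
  · -- bad prime: `π h ∉ 𝔮`, so at most one bad residue, which `π c` avoids
    haveI : IsRegularLocalRing (Localization.AtPrime
        (Q.comap (Ideal.Quotient.mk (Ideal.span {g + C (c * ϖ) * h})))) :=
      IsRegularRing.isRegularLocalRing_localization _
    refine isRegularLocalRing_localization_quotient_of_notMem_sq Q ?_
    intro hG2
    apply hc
    rw [Set.Finite.mem_toFinset, Set.mem_iUnion₂]
    refine ⟨𝔮, ⟨hgq, hcase⟩, c, rfl, ?_⟩
    exact (mem_sq_maximalIdeal_localization_iff_of_eq hcomapq.symm _).mp hG2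
  · -- good prime: the trace is regular at `𝔮`, so every lift is regular at `Q`
    refine isRegularLocalRing_localization_deltaCurve_of_notMem_sq_model_pt π Q 𝔮 hcomapq ?_
    rw [map_add_C_mul_mul_of_map_eq_zero π hπϖ]
    exact hcase

end GenericModel

/-! ## T-ΔLIFT: a homogeneous lift whose dehomogenised Δ-curves are all regular along `ϖ` -/

section ConeLift

variable {O : Type} [CommRing O] [IsDomain O] [IsDiscreteValuationRing O] {ϖ : O}
variable {k : Type} [Field k] [Infinite k]

/-- **T-ΔLIFT — existence of a Δ-regular cone lift.** Let `O` be a DVR with uniformizer `ϖ`, `π : O ↠ k` a surjection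
onto an INFINITE field with `ker π = (ϖ)`, and `g ∈ k[T_0, …, T_{r-1}]` a form of degree `d`. Suppose that on every
chart `i` the primes `𝔮 ∋ g(Tᵢ := 1)` of `k[T_j : j ≠ i]` at which `g(Tᵢ := 1) ∈ 𝔪_𝔮²` — the non-regular points of the
trace `V(g)` in that chart — are finitely many. Then there is a FORM `Φ ∈ O[T]` of degree `d` with `π Φ = g` such that for
every chart `i` the Δ-curve ring `O[T_j : j ≠ i] ⧸ (Φ(Tᵢ := 1))` is a regular local ring at every prime containing `ϖ`.
Construction: `Φ = G + c·ϖ·M` with `G`, `M` homogeneous lifts of `g` and of a form `M̄` of degree `d` avoiding every bad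
`𝔮` on every chart (`exists_isHomogeneous_forall_dehomogenize_notMem`), and `π c` outside the union over the charts of
the finite exclusion sets of `deltaRegularGeneric_mul_model`. [cite: Matsumura1987, Thm. 14.2] [OURS · L1 W4.5b] -/
theorem exists_isHomogeneous_lift_deltaRegular (hϖ : Irreducible ϖ) (π : O →+* k) (hπ : Function.Surjective π)
    (hker : RingHom.ker π = Ideal.span {ϖ}) {r d : ℕ} (g : MvPolynomial (Fin r) k) (hg : g.IsHomogeneous d)
    (hfin : ∀ i : Fin r, {𝔮 : PrimeSpectrum (MvPolynomial {j : Fin r // j ≠ i} k) |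
      dehomogenize i g ∈ 𝔮.asIdeal ∧
      algebraMap (MvPolynomial {j : Fin r // j ≠ i} k) (Localization.AtPrime 𝔮.asIdeal) (dehomogenize i g) ∈
        maximalIdeal (Localization.AtPrime 𝔮.asIdeal) ^ 2}.Finite) :
    ∃ Φ : MvPolynomial (Fin r) O, Φ.IsHomogeneous d ∧ MvPolynomial.map π Φ = g ∧
      ∀ (i : Fin r) (Q : Ideal (MvPolynomial {j : Fin r // j ≠ i} O ⧸ Ideal.span {dehomogenize i Φ})) [Q.IsPrime],
        Ideal.Quotient.mk (Ideal.span {dehomogenize i Φ}) (C ϖ : MvPolynomial {j : Fin r // j ≠ i} O) ∈ Q →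
          IsRegularLocalRing (Localization.AtPrime Q) := by
  classical
  have hπϖ : π ϖ = 0 := by
    rw [← RingHom.mem_ker, hker]
    exact Ideal.mem_span_singleton_self ϖ
  -- Step 1: a form `M̄` of degree `d` avoiding every bad prime on every chart
  let ι := Σ i : Fin r, (hfin i).toFinset
  haveI : Finite ι := inferInstance
  obtain ⟨Mbar, hMbar, hMavoid⟩ := exists_isHomogeneous_forall_dehomogenize_notMem (k := k) d
    (fun t : ι => t.1) (fun t => t.2.1.asIdeal) (fun t => t.2.1.isPrime.ne_top)
  -- Step 2: homogeneous lifts `G` of `g` and `M` of `M̄`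
  obtain ⟨G, hG, hGg⟩ := exists_isHomogeneous_map_eq_of_surjective π hπ g hg
  obtain ⟨M, hM, hMM⟩ := exists_isHomogeneous_map_eq_of_surjective π hπ Mbar hMbar
  -- Step 3: on each chart, the finite exclusion set of the generic-lift theorem
  have hGi : ∀ i : Fin r, MvPolynomial.map π (dehomogenize i G) = dehomogenize i g := fun i => by
    rw [map_dehomogenize, hGg]
  have hMi : ∀ i : Fin r, MvPolynomial.map π (dehomogenize i M) = dehomogenize i Mbar := fun i => by
    rw [map_dehomogenize, hMM]
  have hchart := fun i : Fin r =>
    deltaRegularGeneric_mul_model hϖ π hπ hker (dehomogenize i G) (dehomogenize i M)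
      (by rw [hGi]; exact hfin i)
      (by
        intro 𝔮 h1 h2
        rw [hMi]
        rw [hGi] at h1 h2
        exact hMavoid ⟨i, ⟨𝔮, (hfin i).mem_toFinset.mpr ⟨h1, h2⟩⟩⟩)
  choose S hS using hchart
  -- Step 4: a value of `c` good for all charts
  obtain ⟨y, hy⟩ := Infinite.exists_notMem_finset (Finset.univ.biUnion S)
  obtain ⟨c, rfl⟩ := hπ y
  have hcS : ∀ i, π c ∉ S i := fun i hi => hy (Finset.mem_biUnion.mpr ⟨i, Finset.mem_univ _, hi⟩)
  -- the cone `Φ = G + c·ϖ·M`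
  refine ⟨G + C (c * ϖ) * M, hG.add (hM.C_mul _), ?_, fun i Q _ hQ => ?_⟩
  · rw [map_add_C_mul_mul_of_map_eq_zero π hπϖ, hGg]
  · have hdehom : dehomogenize i (G + C (c * ϖ) * M) = dehomogenize i G + C (c * ϖ) * dehomogenize i M := by
      rw [map_add, map_mul, MvPolynomial.aeval_C, MvPolynomial.algebraMap_eq]
    -- transport `Q` along the (definitional) equality of the chart equations
    have key := hS i c (hcS i)
    revert Q
    rw [hdehom]
    intro Q _ hQ
    exact key Q hQ

/-- **T-ΔLIFT with `ker π = 𝔪_O`** (the spelling of K4 / T-INST, p512946 / p515248: `θ : O ↠ k`; for a DVR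
`ker = 𝔪_O = (ϖ)`). [cite: Matsumura1987, Thm. 14.2] [OURS · L1 W4.5b] -/
theorem exists_isHomogeneous_lift_deltaRegular' (hϖ : Irreducible ϖ) (π : O →+* k) (hπ : Function.Surjective π)
    (hker : RingHom.ker π = maximalIdeal O) {r d : ℕ} (g : MvPolynomial (Fin r) k) (hg : g.IsHomogeneous d)
    (hfin : ∀ i : Fin r, {𝔮 : PrimeSpectrum (MvPolynomial {j : Fin r // j ≠ i} k) |
      dehomogenize i g ∈ 𝔮.asIdeal ∧
      algebraMap (MvPolynomial {j : Fin r // j ≠ i} k) (Localization.AtPrime 𝔮.asIdeal) (dehomogenize i g) ∈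
        maximalIdeal (Localization.AtPrime 𝔮.asIdeal) ^ 2}.Finite) :
    ∃ Φ : MvPolynomial (Fin r) O, Φ.IsHomogeneous d ∧ MvPolynomial.map π Φ = g ∧
      ∀ (i : Fin r) (Q : Ideal (MvPolynomial {j : Fin r // j ≠ i} O ⧸ Ideal.span {dehomogenize i Φ})) [Q.IsPrime],
        Ideal.Quotient.mk (Ideal.span {dehomogenize i Φ}) (C ϖ : MvPolynomial {j : Fin r // j ≠ i} O) ∈ Q →
          IsRegularLocalRing (Localization.AtPrime Q) :=
  exists_isHomogeneous_lift_deltaRegular hϖ π hπ (hker.trans hϖ.maximalIdeal_eq) g hg hfin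

end ConeLift

end Summit.ResolutionOfSingularities.ResolutionOfSingularities.Cruxes.EquisingularLiftNat.Sections

end
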